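import Mathlib
import HarnessLib
import Literature.Geometry.DiscreteGeometry.BondGraph
import Literature.Geometry.DiscreteGeometry.KissingPatterns
import Literature.Algebra.EuclideanLattices.FccBccLattices
import Summits.AtomisticToContinuum.Crystallization.Theorems.PricedLinkCensusSoftLayerPropagationStubMetricDet
import Summits.AtomisticToContinuum.Crystallization.Theorems.PricedLinkCensusSoftLayerPropagationH1RSolve

/-!
# The box solving lemma (crux `SoftLayerPropagation`, line `Sketch`, stub `develop_H1R`)

Route `PricedLinkCensus`, crux `SoftLayerPropagation` (stmt-AtomisticToContinuum-14233), line `Sketch`.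
Helper file for the registered stub `develop_H1R`: the solving lemma for a triple of KNOWN vectors
(all six Gram entries in a box), the engine of the trilateration lemmas (caps, glued octahedra) of the
stub.  Unlike `Theorems.metric_solve` / `Theorems.solve_sq` the triple need not be nearly orthogonal:
the bound is the entrywise evaluation of the adjugate quadratic form `cᵀ adj(G) c`
(`Theorems.norm_sq_mul_det3_sq_eq`) over the box, divided by the entrywise lower bound of `det G`.

* `gram_det_box_lower` — `det G ≥ l₁₁l₂₂l₃₃ − 2m₁₂m₁₃m₂₃ − u₁₁m₂₃² − u₂₂m₁₃² − u₃₃m₁₂²` on the box;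
* `adj_form_box_le` — `cᵀ adj(G) c ≤ Σ sₖ² uₗₗuₘₘ + 2 Σ sₖsₗ (mₖₘmₗₘ + mₖₗ uₘₘ)` on the box;
* **`tri_solve`** — the two combined: `‖v‖² (l₁₁l₂₂l₃₃ − 2m₁₂m₁₃m₂₃ − u₁₁m₂₃² − u₂₂m₁₃² − u₃₃m₁₂²) ≤ …`.

All `[folklore]`.
-/

noncomputable section

namespace Summit.AtomisticToContinuum.Crystallization.Theorems

open Literature.Geometry.DiscreteGeometry

/-- **The Gram determinant over a box.**  With `lᵢᵢ ≤ aᵢ ≤ uᵢᵢ` (`lᵢᵢ ≥ 0`) and `|gᵢⱼ| ≤ mᵢⱼ`: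
`a₁a₂a₃ + 2g₁₂g₁₃g₂₃ − a₁g₂₃² − a₂g₁₃² − a₃g₁₂² ≥ l₁₁l₂₂l₃₃ − 2m₁₂m₁₃m₂₃ − u₁₁m₂₃² − u₂₂m₁₃² − u₃₃m₁₂²`.
[folklore] -/
theorem gram_det_box_lower {a₁ a₂ a₃ g₁₂ g₁₃ g₂₃ l₁₁ u₁₁ l₂₂ u₂₂ l₃₃ u₃₃ m₁₂ m₁₃ m₂₃ : ℝ}
    (hl₁ : 0 ≤ l₁₁) (hl₂ : 0 ≤ l₂₂) (hl₃ : 0 ≤ l₃₃) (hm₁₂ : 0 ≤ m₁₂) (hm₁₃ : 0 ≤ m₁₃) (_hm₂₃ : 0 ≤ m₂₃)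
    (ha₁ : l₁₁ ≤ a₁) (ha₁' : a₁ ≤ u₁₁) (ha₂ : l₂₂ ≤ a₂) (ha₂' : a₂ ≤ u₂₂) (ha₃ : l₃₃ ≤ a₃) (ha₃' : a₃ ≤ u₃₃)
    (h₁₂ : |g₁₂| ≤ m₁₂) (h₁₃ : |g₁₃| ≤ m₁₃) (h₂₃ : |g₂₃| ≤ m₂₃) :
    l₁₁ * l₂₂ * l₃₃ - 2 * m₁₂ * m₁₃ * m₂₃ - u₁₁ * m₂₃ ^ 2 - u₂₂ * m₁₃ ^ 2 - u₃₃ * m₁₂ ^ 2 ≤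
      a₁ * a₂ * a₃ + 2 * g₁₂ * g₁₃ * g₂₃ - a₁ * g₂₃ ^ 2 - a₂ * g₁₃ ^ 2 - a₃ * g₁₂ ^ 2 := by
  have a₁0 : 0 ≤ a₁ := hl₁.trans ha₁
  have a₂0 : 0 ≤ a₂ := hl₂.trans ha₂
  have a₃0 : 0 ≤ a₃ := hl₃.trans ha₃
  have s₁₂ : g₁₂ ^ 2 ≤ m₁₂ ^ 2 := sq_le_sq' (abs_le.1 h₁₂).1 (abs_le.1 h₁₂).2
  have s₁₃ : g₁₃ ^ 2 ≤ m₁₃ ^ 2 := sq_le_sq' (abs_le.1 h₁₃).1 (abs_le.1 h₁₃).2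
  have s₂₃ : g₂₃ ^ 2 ≤ m₂₃ ^ 2 := sq_le_sq' (abs_le.1 h₂₃).1 (abs_le.1 h₂₃).2
  have e1 : l₁₁ * l₂₂ * l₃₃ ≤ a₁ * a₂ * a₃ := by
    calc l₁₁ * l₂₂ * l₃₃ ≤ a₁ * l₂₂ * l₃₃ := by gcongr
      _ ≤ a₁ * a₂ * l₃₃ := by gcongr
      _ ≤ a₁ * a₂ * a₃ := by gcongr
  have e2 : |g₁₂ * g₁₃ * g₂₃| ≤ m₁₂ * m₁₃ * m₂₃ := by
    rw [abs_mul, abs_mul]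
    exact mul_le_mul (mul_le_mul h₁₂ h₁₃ (abs_nonneg _) hm₁₂) h₂₃ (abs_nonneg _) (mul_nonneg hm₁₂ hm₁₃)
  have e2' := (abs_le.1 e2).1
  have e3 : a₁ * g₂₃ ^ 2 ≤ u₁₁ * m₂₃ ^ 2 := mul_le_mul ha₁' s₂₃ (sq_nonneg _) (a₁0.trans ha₁')
  have e4 : a₂ * g₁₃ ^ 2 ≤ u₂₂ * m₁₃ ^ 2 := mul_le_mul ha₂' s₁₃ (sq_nonneg _) (a₂0.trans ha₂')
  have e5 : a₃ * g₁₂ ^ 2 ≤ u₃₃ * m₁₂ ^ 2 := mul_le_mul ha₃' s₁₂ (sq_nonneg _) (a₃0.trans ha₃')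
  linarith

/-- **The adjugate quadratic form over a box.**  With `|cₖ| ≤ sₖ`, `0 ≤ aᵢ ≤ uᵢᵢ`, `|gᵢⱼ| ≤ mᵢⱼ`:
`cᵀ adj(G) c ≤ s₁²u₂₂u₃₃ + s₂²u₁₁u₃₃ + s₃²u₁₁u₂₂ + 2 (s₁s₂(m₁₃m₂₃ + m₁₂u₃₃) + s₁s₃(m₁₂m₂₃ + m₁₃u₂₂) + s₂s₃(m₁₂m₁₃ + m₂₃u₁₁))`.
[folklore] -/
theorem adj_form_box_le {c₁ c₂ c₃ a₁ a₂ a₃ g₁₂ g₁₃ g₂₃ u₁₁ u₂₂ u₃₃ m₁₂ m₁₃ m₂₃ s₁ s₂ s₃ : ℝ}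
    (hs₁ : 0 ≤ s₁) (hs₂ : 0 ≤ s₂) (hs₃ : 0 ≤ s₃) (hm₁₂ : 0 ≤ m₁₂) (hm₁₃ : 0 ≤ m₁₃) (_hm₂₃ : 0 ≤ m₂₃)
    (ha₁ : 0 ≤ a₁) (ha₁' : a₁ ≤ u₁₁) (ha₂ : 0 ≤ a₂) (ha₂' : a₂ ≤ u₂₂) (ha₃ : 0 ≤ a₃) (ha₃' : a₃ ≤ u₃₃)
    (h₁₂ : |g₁₂| ≤ m₁₂) (h₁₃ : |g₁₃| ≤ m₁₃) (h₂₃ : |g₂₃| ≤ m₂₃)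
    (hc₁ : |c₁| ≤ s₁) (hc₂ : |c₂| ≤ s₂) (hc₃ : |c₃| ≤ s₃) :
    c₁ ^ 2 * (a₂ * a₃ - g₂₃ ^ 2) + c₂ ^ 2 * (a₁ * a₃ - g₁₃ ^ 2) + c₃ ^ 2 * (a₁ * a₂ - g₁₂ ^ 2) +
      2 * (c₁ * c₂) * (g₁₃ * g₂₃ - g₁₂ * a₃) + 2 * (c₁ * c₃) * (g₁₂ * g₂₃ - g₁₃ * a₂) +
      2 * (c₂ * c₃) * (g₁₂ * g₁₃ - g₂₃ * a₁) ≤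
    s₁ ^ 2 * (u₂₂ * u₃₃) + s₂ ^ 2 * (u₁₁ * u₃₃) + s₃ ^ 2 * (u₁₁ * u₂₂) +
      2 * (s₁ * s₂ * (m₁₃ * m₂₃ + m₁₂ * u₃₃) + s₁ * s₃ * (m₁₂ * m₂₃ + m₁₃ * u₂₂) +
        s₂ * s₃ * (m₁₂ * m₁₃ + m₂₃ * u₁₁)) := by
  have t₁ : c₁ ^ 2 ≤ s₁ ^ 2 := sq_le_sq' (abs_le.1 hc₁).1 (abs_le.1 hc₁).2
  have t₂ : c₂ ^ 2 ≤ s₂ ^ 2 := sq_le_sq' (abs_le.1 hc₂).1 (abs_le.1 hc₂).2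
  have t₃ : c₃ ^ 2 ≤ s₃ ^ 2 := sq_le_sq' (abs_le.1 hc₃).1 (abs_le.1 hc₃).2
  have u₁0 : 0 ≤ u₁₁ := ha₁.trans ha₁'
  have u₂0 : 0 ≤ u₂₂ := ha₂.trans ha₂'
  have u₃0 : 0 ≤ u₃₃ := ha₃.trans ha₃'
  -- diagonal terms
  have d₁ : c₁ ^ 2 * (a₂ * a₃ - g₂₃ ^ 2) ≤ s₁ ^ 2 * (u₂₂ * u₃₃) := by
    have h1 : a₂ * a₃ - g₂₃ ^ 2 ≤ u₂₂ * u₃₃ := by nlinarith [mul_le_mul ha₂' ha₃' ha₃ u₂0, sq_nonneg g₂₃]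
    have h2 : c₁ ^ 2 * (a₂ * a₃ - g₂₃ ^ 2) ≤ c₁ ^ 2 * (u₂₂ * u₃₃) := mul_le_mul_of_nonneg_left h1 (sq_nonneg _)
    exact h2.trans (mul_le_mul_of_nonneg_right t₁ (mul_nonneg u₂0 u₃0))
  have d₂ : c₂ ^ 2 * (a₁ * a₃ - g₁₃ ^ 2) ≤ s₂ ^ 2 * (u₁₁ * u₃₃) := by
    have h1 : a₁ * a₃ - g₁₃ ^ 2 ≤ u₁₁ * u₃₃ := by nlinarith [mul_le_mul ha₁' ha₃' ha₃ u₁0, sq_nonneg g₁₃]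
    have h2 : c₂ ^ 2 * (a₁ * a₃ - g₁₃ ^ 2) ≤ c₂ ^ 2 * (u₁₁ * u₃₃) := mul_le_mul_of_nonneg_left h1 (sq_nonneg _)
    exact h2.trans (mul_le_mul_of_nonneg_right t₂ (mul_nonneg u₁0 u₃0))
  have d₃ : c₃ ^ 2 * (a₁ * a₂ - g₁₂ ^ 2) ≤ s₃ ^ 2 * (u₁₁ * u₂₂) := by
    have h1 : a₁ * a₂ - g₁₂ ^ 2 ≤ u₁₁ * u₂₂ := by nlinarith [mul_le_mul ha₁' ha₂' ha₂ u₁0, sq_nonneg g₁₂]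
    have h2 : c₃ ^ 2 * (a₁ * a₂ - g₁₂ ^ 2) ≤ c₃ ^ 2 * (u₁₁ * u₂₂) := mul_le_mul_of_nonneg_left h1 (sq_nonneg _)
    exact h2.trans (mul_le_mul_of_nonneg_right t₃ (mul_nonneg u₁0 u₂0))
  -- off-diagonal terms
  have key : ∀ {x y p q r a mx my mp mq mr ua : ℝ}, 0 ≤ mx → 0 ≤ my → 0 ≤ mp → 0 ≤ a → a ≤ ua →
      |x| ≤ mx → |y| ≤ my → |p| ≤ mp → |q| ≤ mq → |r| ≤ mr →
      2 * (x * y) * (p * q - r * a) ≤ 2 * (mx * my * (mp * mq + mr * ua)) := by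
    intro x y p q r a mx my mp mq mr ua hx0 hy0 hp0 ha hua hx hy hp hq hr
    have hxy : |x * y| ≤ mx * my := by rw [abs_mul]; exact mul_le_mul hx hy (abs_nonneg _) hx0
    have hpq : |p * q| ≤ mp * mq := by rw [abs_mul]; exact mul_le_mul hp hq (abs_nonneg _) hp0
    have hra : |r * a| ≤ mr * ua := by
      rw [abs_mul, abs_of_nonneg ha]; exact mul_le_mul hr hua ha ((abs_nonneg _).trans hr)
    have h1 : |p * q - r * a| ≤ mp * mq + mr * ua :=
      (abs_sub _ _).trans (add_le_add hpq hra)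
    have h2 : |x * y * (p * q - r * a)| ≤ mx * my * (mp * mq + mr * ua) := by
      rw [abs_mul]; exact mul_le_mul hxy h1 (abs_nonneg _) (mul_nonneg hx0 hy0)
    have h3 := (abs_le.1 h2).2
    linarith
  have o₁₂ := key hs₁ hs₂ hm₁₃ ha₃ ha₃' hc₁ hc₂ h₁₃ h₂₃ h₁₂
  have o₁₃ := key hs₁ hs₃ hm₁₂ ha₂ ha₂' hc₁ hc₃ h₁₂ h₂₃ h₁₃
  have o₂₃ := key hs₂ hs₃ hm₁₂ ha₁ ha₁' hc₂ hc₃ h₁₂ h₁₃ h₂₃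
  linarith

/-- **The box solving lemma (`tri_solve`).**  For vectors `v, n₁, n₂, n₃` of `ℝ³` with Gram entries in
a box (`lᵢᵢ ≤ ‖nᵢ‖² ≤ uᵢᵢ`, `|⟪nᵢ,nⱼ⟫| ≤ mᵢⱼ`) and `|⟪v,nₖ⟫| ≤ sₖ`:
`‖v‖² (l₁₁l₂₂l₃₃ − 2m₁₂m₁₃m₂₃ − u₁₁m₂₃² − u₂₂m₁₃² − u₃₃m₁₂²)
  ≤ s₁²u₂₂u₃₃ + s₂²u₁₁u₃₃ + s₃²u₁₁u₂₂ + 2 (s₁s₂(m₁₃m₂₃ + m₁₂u₃₃) + s₁s₃(m₁₂m₂₃ + m₁₃u₂₂) + s₂s₃(m₁₂m₁₃ + m₂₃u₁₁))`.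
Proof: `‖v‖² det² = cᵀ adj(G) c` entrywise, and `det² = det G` entrywise from below. [folklore] -/
theorem tri_solve : ∀ {s₁ s₂ s₃ l₁₁ u₁₁ l₂₂ u₂₂ l₃₃ u₃₃ m₁₂ m₁₃ m₂₃ : ℝ}, 0 ≤ s₁ → 0 ≤ s₂ → 0 ≤ s₃ → 0 ≤ l₁₁ → 0 ≤ l₂₂ → 0 ≤ l₃₃ → 0 ≤ m₁₂ → 0 ≤ m₁₃ → 0 ≤ m₂₃ → ∀ (v n₁ n₂ n₃ : EuclideanSpace ℝ (Fin 3)), l₁₁ ≤ ‖n₁‖ ^ 2 → ‖n₁‖ ^ 2 ≤ u₁₁ → l₂₂ ≤ ‖n₂‖ ^ 2 → ‖n₂‖ ^ 2 ≤ u₂₂ → l₃₃ ≤ ‖n₃‖ ^ 2 → ‖n₃‖ ^ 2 ≤ u₃₃ → |inner ℝ n₁ n₂| ≤ m₁₂ → |inner ℝ n₁ n₃| ≤ m₁₃ → |inner ℝ n₂ n₃| ≤ m₂₃ → |inner ℝ v n₁| ≤ s₁ → |inner ℝ v n₂| ≤ s₂ → |inner ℝ v n₃| ≤ s₃ → ‖v‖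 ^ 2 * (l₁₁ * l₂₂ * l₃₃ - 2 * m₁₂ * m₁₃ * m₂₃ - u₁₁ * m₂₃ ^ 2 - u₂₂ * m₁₃ ^ 2 - u₃₃ * m₁₂ ^ 2) ≤ s₁ ^ 2 * (u₂₂ * u₃₃) + s₂ ^ 2 * (u₁₁ * u₃₃) + s₃ ^ 2 * (u₁₁ * u₂₂) + 2 * (s₁ * s₂ * (m₁₃ * m₂₃ + m₁₂ * u₃₃) + s₁ * s₃ * (m₁₂ * m₂₃ + m₁₃ * u₂₂) + s₂ * s₃ * (m₁₂ * m₁₃ + m₂₃ * u₁₁)) := by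
  intro s₁ s₂ s₃ l₁₁ u₁₁ l₂₂ u₂₂ l₃₃ u₃₃ m₁₂ m₁₃ m₂₃ hs₁ hs₂ hs₃ hl₁ hl₂ hl₃ hm₁₂ hm₁₃ hm₂₃ v n₁ n₂ n₃
    ha₁ ha₁' ha₂ ha₂' ha₃ ha₃' h₁₂ h₁₃ h₂₃ hv₁ hv₂ hv₃
  set T2 := Matrix.det ![WithLp.ofLp n₁, WithLp.ofLp n₂, WithLp.ofLp n₃] ^ 2 with hT2
  have up : ‖v‖ ^ 2 * T2 ≤ s₁ ^ 2 * (u₂₂ * u₃₃) + s₂ ^ 2 * (u₁₁ * u₃₃) + s₃ ^ 2 * (u₁₁ * u₂₂) +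
      2 * (s₁ * s₂ * (m₁₃ * m₂₃ + m₁₂ * u₃₃) + s₁ * s₃ * (m₁₂ * m₂₃ + m₁₃ * u₂₂) +
        s₂ * s₃ * (m₁₂ * m₁₃ + m₂₃ * u₁₁)) := by
    rw [hT2, norm_sq_mul_det3_sq_eq]
    exact adj_form_box_le hs₁ hs₂ hs₃ hm₁₂ hm₁₃ hm₂₃ (hl₁.trans ha₁) ha₁' (hl₂.trans ha₂) ha₂'
      (hl₃.trans ha₃) ha₃' h₁₂ h₁₃ h₂₃ hv₁ hv₂ hv₃
  have lo : l₁₁ * l₂₂ * l₃₃ - 2 * m₁₂ * m₁₃ * m₂₃ - u₁₁ * m₂₃ ^ 2 - u₂₂ * m₁₃ ^ 2 - u₃₃ * m₁₂ ^ 2 ≤ T2 := by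
    rw [hT2, det3_sq_eq_gram]
    have := gram_det_box_lower hl₁ hl₂ hl₃ hm₁₂ hm₁₃ hm₂₃ ha₁ ha₁' ha₂ ha₂' ha₃ ha₃' h₁₂ h₁₃ h₂₃
    linarith
  have := mul_le_mul_of_nonneg_left lo (sq_nonneg ‖v‖)
  linarith

end Summit.AtomisticToContinuum.Crystallization.Theorems

end
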